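import Mathlib.NumberTheory.Padics.Hensel
import Mathlib.NumberTheory.Padics.RingHoms
import Mathlib.FieldTheory.Finite.Basic
import Mathlib.RingTheory.RootsOfUnity.PrimitiveRoots
import Mathlib.Algebra.Ring.GeomSum
import Literature.NumberTheory.EllipticCurves.Kato2004.SemilocalDecompositionProofs
import HarnessLib

/-!
# Roots of unity of order prime to `p` in `ℤ_p` and `ℚ_p`: `μ_{p−1} ⊂ ℤ_p^×`, and `μ_m ⊂ ℚ_p ⇔ m ∣ p − 1` (`p ∤ m`)

`Literature/NumberTheory/LocalFields/PadicRootsOfUnity.lean`. Gouvêa, *p-adic Numbers* (1993), §4.6, Prop. 4.6.1: «for `m` not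
divisible by `p`, `ℚ_p` contains a primitive `m`-th root of unity if and only if `m ∣ p − 1`; in particular `ℤ_p^×` contains the
`(p−1)`-st roots of unity» (Hensel's lemma for `X^{p−1} − 1`); Serre, *A Course in Arithmetic*, Ch. II §3.1 Prop. 7 / Cor.
(`U = V × U₁`, `V = {x : x^{p−1} = 1}` cyclic of order `p − 1`, mapping isomorphically onto `𝔽_p^×`).

Results (all PROVED, Mathlib only):
* `padicInt_eq_one_of_pow_eq_one_of_norm_sub_one_lt` — a root of unity of order prime to `p` which is a ONE-unit is `1`
  (the geometric sum `1 + ζ + ⋯ + ζ^{n−1} ≡ n ≢ 0 (mod p)` is a unit and kills `ζ − 1`);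
* `padicInt_eq_of_pow_eq_one_of_toZMod_eq` — reduction mod `p` is INJECTIVE on `n`-th roots of unity, `p ∤ n`;
* existence `μ_{p−1} ⊂ ℤ_p` is the tree's `EllipticCurves.Kato2004.padicInt_exists_isPrimitiveRoot_sub_one` (BY NAME); here:
  `padic_exists_isPrimitiveRoot_sub_one` (in `ℚ_p`), `padicInt_exists_isPrimitiveRoot_of_dvd` / `padic_exists_isPrimitiveRoot_of_dvd`
  (`m ∣ p − 1`), `card_rootsOfUnity_padicInt_sub_one`;
* `dvd_sub_one_of_isPrimitiveRoot_padic` — conversely a primitive `m`-th root of unity in `ℚ_p` with `p ∤ m` forces `m ∣ p − 1`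
  (it is integral; its reduction satisfies Fermat `r^{p−1} = 1`, so `ζ^{p−1} = 1` by injectivity);
* **`padic_exists_isPrimitiveRoot_iff`** — Gouvêa Prop. 4.6.1: for `p ∤ m`, `(∃ ζ : ℚ_p, IsPrimitiveRoot ζ m) ↔ m ∣ p − 1`.
The tree's `PadicMultiplicativeRepresentatives` / Yu-engine files take `(hζ : IsPrimitiveRoot ζ (p − 1))` as a HYPOTHESIS; this file
supplies it. Classical; nothing beyond Gouvêa/Serre is claimed.

## References
* [Gouvea1993PadicNumbers] F. Q. Gouvêa, *p-adic Numbers: An Introduction*, Universitext, Springer 1993 — §4.6, Prop. 4.6.1.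
* [Serre1973] J.-P. Serre, *A Course in Arithmetic*, GTM 7, Springer 1973 — Ch. II §3.1, Prop. 7 and Corollary.
-/

noncomputable section

open Polynomial

namespace Literature.NumberTheory.LocalFields

variable {p : ℕ} [Fact p.Prime]

/-! ### Reduction mod `p` and one-units -/

/-- `‖x‖ < 1 ↔ x ≡ 0 (mod p)`. [cite: Gouvea1993PadicNumbers, §4.6] -/
private theorem padicInt_norm_lt_one_iff_toZMod (x : ℤ_[p]) : ‖x‖ < 1 ↔ PadicInt.toZMod x = 0 := by
  rw [← PadicInt.mem_nonunits, ← IsLocalRing.mem_maximalIdeal, ← PadicInt.ker_toZMod, RingHom.mem_ker]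

/-- `x` is a unit of `ℤ_p` iff `x ≢ 0 (mod p)`. [cite: Gouvea1993PadicNumbers, §4.6] -/
private theorem padicInt_isUnit_iff_toZMod_ne_zero (x : ℤ_[p]) : IsUnit x ↔ PadicInt.toZMod x ≠ 0 := by
  rw [Ne, ← padicInt_norm_lt_one_iff_toZMod, PadicInt.isUnit_iff, not_lt]
  exact ⟨fun h => h.ge, fun h => le_antisymm (PadicInt.norm_le_one x) h⟩

/-- **A root of unity of order prime to `p` which is a one-unit is trivial** (Serre II §3.1: `V ∩ U₁ = 1`): if `p ∤ n`, `ζⁿ = 1` and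
`‖ζ − 1‖ < 1` then `ζ = 1` — the geometric sum `1 + ζ + ⋯ + ζ^{n−1}` reduces to `n ≢ 0 (mod p)`, so it is a unit, and it kills `ζ − 1`.
[cite: Serre1973, Ch. II §3.1 Prop. 7] -/
theorem padicInt_eq_one_of_pow_eq_one_of_norm_sub_one_lt {n : ℕ} (hn : ¬ p ∣ n) {ζ : ℤ_[p]} (hζ : ζ ^ n = 1)
    (h1 : ‖ζ - 1‖ < 1) : ζ = 1 := by
  have hz : PadicInt.toZMod ζ = 1 := by
    have h := (padicInt_norm_lt_one_iff_toZMod _).mp h1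
    rwa [map_sub, map_one, sub_eq_zero] at h
  have hS : PadicInt.toZMod (∑ i ∈ Finset.range n, ζ ^ i) = (n : ZMod p) := by
    rw [map_sum]
    simp only [map_pow, hz, one_pow, Finset.sum_const, Finset.card_range, nsmul_eq_mul, mul_one]
  have hn' : ((n : ℕ) : ZMod p) ≠ 0 := by
    rw [Ne, ZMod.natCast_eq_zero_iff]
    exact hn
  have hunit : IsUnit (∑ i ∈ Finset.range n, ζ ^ i) := by
    rw [padicInt_isUnit_iff_toZMod_ne_zero, hS]
    exact hn'
  have hmul : (∑ i ∈ Finset.range n, ζ ^ i) * (ζ - 1) = 0 := by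
    rw [geom_sum_mul, hζ, sub_self]
  exact sub_eq_zero.mp (hunit.mul_right_eq_zero.mp hmul)

omit [Fact p.Prime] in
/-- `p ∤ n ⇒ n ≠ 0`. [folklore] -/
private theorem ne_zero_of_not_dvd {n : ℕ} (hn : ¬ p ∣ n) : n ≠ 0 := by
  rintro rfl
  exact hn (dvd_zero p)

/-- **Reduction mod `p` is injective on the `n`-th roots of unity, `p ∤ n`** (Serre II §3.1 Cor.: `V → 𝔽_p^×` is injective).
[cite: Serre1973, Ch. II §3.1 Prop. 7] -/
theorem padicInt_eq_of_pow_eq_one_of_toZMod_eq {n : ℕ} (hn : ¬ p ∣ n) {ζ₁ ζ₂ : ℤ_[p]} (h₁ : ζ₁ ^ n = 1) (h₂ : ζ₂ ^ n = 1)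
    (h : PadicInt.toZMod ζ₁ = PadicInt.toZMod ζ₂) : ζ₁ = ζ₂ := by
  have hn0 : n ≠ 0 := ne_zero_of_not_dvd hn
  obtain ⟨u, rfl⟩ := IsUnit.of_pow_eq_one h₂ hn0
  -- `η := ζ₁ u⁻¹` is an `n`-th root of unity reducing to `1`
  have hun : u ^ n = 1 := Units.ext (by rw [Units.val_pow_eq_pow_val, h₂, Units.val_one])
  have hηn : (ζ₁ * ((u⁻¹ : ℤ_[p]ˣ) : ℤ_[p])) ^ n = 1 := by
    rw [mul_pow, h₁, one_mul, ← Units.val_pow_eq_pow_val, inv_pow, hun, inv_one, Units.val_one]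
  have hη1 : PadicInt.toZMod (ζ₁ * ((u⁻¹ : ℤ_[p]ˣ) : ℤ_[p])) = 1 := by
    rw [map_mul, h, ← map_mul, Units.mul_inv, map_one]
  have hη : ζ₁ * ((u⁻¹ : ℤ_[p]ˣ) : ℤ_[p]) = 1 := by
    refine padicInt_eq_one_of_pow_eq_one_of_norm_sub_one_lt hn hηn ?_
    rw [padicInt_norm_lt_one_iff_toZMod, map_sub, hη1, map_one, sub_self]
  calc ζ₁ = ζ₁ * ((u⁻¹ : ℤ_[p]ˣ) : ℤ_[p]) * (u : ℤ_[p]) := by rw [Units.inv_mul_cancel_right]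
    _ = ↑u := by rw [hη, one_mul]

/-! ### Existence: `μ_{p−1} ⊂ ℤ_p^×` -/

-- `μ_{p−1} ⊂ ℤ_p^×` itself — `∃ ζ : ℤ_[p], IsPrimitiveRoot ζ (p - 1)` — is ALREADY in the tree (Hensel at a lift of a generator of
-- `(ℤ/p)^×`): `Literature.NumberTheory.EllipticCurves.Kato2004.padicInt_exists_isPrimitiveRoot_sub_one` (Kato 2004 §12.1 leg,
-- `SemilocalDecompositionProofs.lean`), consumed BY NAME below.

/-- The same in `ℚ_p`. [cite: Gouvea1993PadicNumbers, Prop. 4.6.1 (§4.6)] -/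
theorem padic_exists_isPrimitiveRoot_sub_one : ∃ ζ : ℚ_[p], IsPrimitiveRoot ζ (p - 1) := by
  obtain ⟨ζ, hζ⟩ := EllipticCurves.Kato2004.padicInt_exists_isPrimitiveRoot_sub_one p
  exact ⟨(ζ : ℚ_[p]), hζ.map_of_injective (f := PadicInt.Coe.ringHom) Subtype.val_injective⟩

/-- **Gouvêa Prop. 4.6.1 (⇐)**: for `m ∣ p − 1` there is a primitive `m`-th root of unity in `ℤ_p` (a power of `ζ_{p−1}`).
[cite: Gouvea1993PadicNumbers, Prop. 4.6.1 (§4.6)] -/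
theorem padicInt_exists_isPrimitiveRoot_of_dvd {m : ℕ} (hm : m ∣ p - 1) : ∃ ζ : ℤ_[p], IsPrimitiveRoot ζ m := by
  obtain ⟨ζ, hζ⟩ := EllipticCurves.Kato2004.padicInt_exists_isPrimitiveRoot_sub_one p
  have hp0 : p - 1 ≠ 0 := (Nat.sub_pos_of_lt (Fact.out : p.Prime).one_lt).ne'
  have hm0 : m ≠ 0 := fun h => hp0 (Nat.eq_zero_of_zero_dvd (h ▸ hm))
  have hq0 : (p - 1) / m ≠ 0 := (Nat.div_pos (Nat.le_of_dvd (Nat.pos_of_ne_zero hp0) hm) (Nat.pos_of_ne_zero hm0)).ne'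
  refine ⟨ζ ^ ((p - 1) / m), ?_⟩
  have h := hζ.pow_of_dvd hq0 (Nat.div_dvd_of_dvd hm)
  rwa [Nat.div_div_self hm hp0] at h

/-- … and in `ℚ_p`. [cite: Gouvea1993PadicNumbers, Prop. 4.6.1 (§4.6)] -/
theorem padic_exists_isPrimitiveRoot_of_dvd {m : ℕ} (hm : m ∣ p - 1) : ∃ ζ : ℚ_[p], IsPrimitiveRoot ζ m := by
  obtain ⟨ζ, hζ⟩ := padicInt_exists_isPrimitiveRoot_of_dvd (p := p) hm
  exact ⟨(ζ : ℚ_[p]), hζ.map_of_injective (f := PadicInt.Coe.ringHom) Subtype.val_injective⟩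

/-! ### The converse: `μ_m ⊂ ℚ_p`, `p ∤ m` forces `m ∣ p − 1` -/

/-- A root of unity in `ℚ_p` is a `p`-adic integer. [cite: Gouvea1993PadicNumbers, §4.6] -/
theorem padic_norm_eq_one_of_pow_eq_one {m : ℕ} (hm : m ≠ 0) {ζ : ℚ_[p]} (hζ : ζ ^ m = 1) : ‖ζ‖ = 1 := by
  have h : ‖ζ‖ ^ m = 1 := by rw [← norm_pow, hζ, norm_one]
  exact (pow_eq_one_iff_of_nonneg (norm_nonneg ζ) hm).mp h

/-- **Gouvêa Prop. 4.6.1 (⇒)**: a primitive `m`-th root of unity in `ℚ_p` with `p ∤ m` forces `m ∣ p − 1` — it lies in `ℤ_p`, its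
reduction `r` satisfies Fermat `r^{p−1} = 1`, hence `ζ^{p−1} = 1` by injectivity of reduction on `m`-th roots of unity.
[cite: Gouvea1993PadicNumbers, Prop. 4.6.1 (§4.6)] -/
theorem dvd_sub_one_of_isPrimitiveRoot_padic {m : ℕ} (hm : ¬ p ∣ m) {ζ : ℚ_[p]} (hζ : IsPrimitiveRoot ζ m) : m ∣ p - 1 := by
  have hm0 : m ≠ 0 := ne_zero_of_not_dvd hm
  -- `ζ` is integral
  have hnorm : ‖ζ‖ ≤ 1 := (padic_norm_eq_one_of_pow_eq_one hm0 hζ.pow_eq_one).le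
  set z : ℤ_[p] := ⟨ζ, hnorm⟩ with hzdef
  have hz : IsPrimitiveRoot z m :=
    IsPrimitiveRoot.of_map_of_injective (f := PadicInt.Coe.ringHom) (by exact hζ) Subtype.val_injective
  have hz0 : PadicInt.toZMod z ≠ 0 := (padicInt_isUnit_iff_toZMod_ne_zero _).mp (hz.isUnit hm0)
  -- Fermat for the reduction, lifted back by injectivity
  have hred : PadicInt.toZMod (z ^ (p - 1)) = PadicInt.toZMod 1 := by
    rw [map_pow, ZMod.pow_card_sub_one_eq_one hz0, map_one]
  have hpow : z ^ (p - 1) = 1 :=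
    padicInt_eq_of_pow_eq_one_of_toZMod_eq hm (by rw [← pow_mul, mul_comm, pow_mul, hz.pow_eq_one, one_pow]) (one_pow m) hred
  exact hz.dvd_of_pow_eq_one _ hpow

/-- **Gouvêa, Prop. 4.6.1**: for `m` prime to `p`, `ℚ_p` contains a primitive `m`-th root of unity iff `m ∣ p − 1`.
[cite: Gouvea1993PadicNumbers, Prop. 4.6.1 (§4.6)] -/
theorem padic_exists_isPrimitiveRoot_iff {m : ℕ} (hm : ¬ p ∣ m) : (∃ ζ : ℚ_[p], IsPrimitiveRoot ζ m) ↔ m ∣ p - 1 :=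
  ⟨fun ⟨_, hζ⟩ => dvd_sub_one_of_isPrimitiveRoot_padic hm hζ, padic_exists_isPrimitiveRoot_of_dvd⟩

/-- The `ℤ_p` form of Prop. 4.6.1. [cite: Gouvea1993PadicNumbers, Prop. 4.6.1 (§4.6)] -/
theorem padicInt_exists_isPrimitiveRoot_iff {m : ℕ} (hm : ¬ p ∣ m) : (∃ ζ : ℤ_[p], IsPrimitiveRoot ζ m) ↔ m ∣ p - 1 := by
  refine ⟨fun ⟨ζ, hζ⟩ => ?_, padicInt_exists_isPrimitiveRoot_of_dvd⟩
  exact dvd_sub_one_of_isPrimitiveRoot_padic hm (hζ.map_of_injective (f := PadicInt.Coe.ringHom) Subtype.val_injective)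

/-- **`μ_{p−1}(ℤ_p)` has exactly `p − 1` elements** (Serre II §3.1 Cor.: `V` is cyclic of order `p − 1`).
[cite: Serre1973, Ch. II §3.1 Prop. 7] -/
theorem card_rootsOfUnity_padicInt_sub_one [NeZero (p - 1)] : Nat.card (rootsOfUnity (p - 1) ℤ_[p]) = p - 1 := by
  obtain ⟨ζ, hζ⟩ := EllipticCurves.Kato2004.padicInt_exists_isPrimitiveRoot_sub_one p
  exact hζ.card_rootsOfUnity

end Literature.NumberTheory.LocalFields

end
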